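import Mathlib

/-!
# GapsEvoDoors — computable rational polynomial toolkit (PW-SOS witness port, part 1)

Cell rh-gaps (D-0143/D-0145), route `GapsEvoDoors`. Engine EVO-TF-2's certified door-(a) witnesses
of record (results/rh-gaps-eng-2/W-simple-rh-gaps-eng-2: the two-square Paley–Wiener SOS objects
`r(u) = (λ² − u²)·(W₁ h₁(u)² + W₂ h₂(u)²)`, `ĥ_i` even polynomial bumps) have cosine transforms that
are explicit PIECEWISE POLYNOMIALS with large rational coefficients (degree 29) plus a `1/π²` part.
To port them to the kernel without `native_decide` we keep every polynomial as a COMPUTABLE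
coefficient list `List ℚ` and prove, once and for all, that the list operations used
(`add`, `smul`, `mulX`, `mul`, `deriv`, `prim`, `shift`, `compSq`, the interval autocorrelation
`conv`, and the lower-bound certificate `lb` / `chainOK`) mean what they should under real
evaluation `eval`. Every numerical fact downstream is then an identity / inequality of rationals
checked by `decide +kernel` (kernel evaluation; standard axioms only).

Pure elementary real analysis; no RH, no zeta; nothing here bears on the truth of RH.
-/

set_option linter.dupNamespace false  -- the mandated namespace repeats `RiemannHypothesis`

namespace Summit.RiemannHypothesis.RiemannHypothesis.Theorems.GapsEvoDoorsPW

open MeasureTheory Set intervalIntegral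

/-- Polynomials with rational coefficients as ascending coefficient lists `[c₀, c₁, …]`. -/
abbrev Poly := List ℚ

namespace Poly

/-! ## Evaluation -/

/-- Real evaluation (Horner): `eval [c₀, c₁, …] x = c₀ + x·(c₁ + x·(…))`. -/
def eval : Poly → ℝ → ℝ
  | [], _ => 0
  | c :: p, x => (c : ℝ) + x * eval p x

/-- Rational evaluation (Horner). -/
def evalQ : Poly → ℚ → ℚ
  | [], _ => 0
  | c :: p, x => c + x * evalQ p x

/-- `eval [] = 0`. -/
@[simp] theorem eval_nil (x : ℝ) : eval [] x = 0 := rfl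

/-- Horner step. -/
@[simp] theorem eval_cons (c : ℚ) (p : Poly) (x : ℝ) : eval (c :: p) x = (c : ℝ) + x * eval p x := rfl

/-- Real evaluation at a rational point is the cast of the rational evaluation. -/
theorem eval_ratCast (p : Poly) (x : ℚ) : eval p (x : ℝ) = ((evalQ p x : ℚ) : ℝ) := by
  induction p with
  | nil => simp [evalQ]
  | cons c p ih => simp only [eval_cons, evalQ, ih]; push_cast; ring

/-- `eval p` is continuous. -/
theorem continuous_eval (p : Poly) : Continuous (eval p) := by
  induction p with
  | nil => exact continuous_const
  | cons c p ih => exact continuous_const.add (continuous_id.mul ih)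

/-! ## Arithmetic -/

/-- Sum. -/
def add : Poly → Poly → Poly
  | [], q => q
  | a :: p, [] => a :: p
  | a :: p, b :: q => (a + b) :: add p q

/-- `eval` is additive. -/
@[simp] theorem eval_add (p q : Poly) (x : ℝ) : eval (add p q) x = eval p x + eval q x := by
  induction p generalizing q with
  | nil => simp [add]
  | cons a p ih =>
    cases q with
    | nil => simp [add]
    | cons b q => simp only [add, eval_cons, ih]; push_cast; ring

/-- Scalar multiple. -/
def smul (c : ℚ) : Poly → Poly
  | [] => []
  | a :: p => (c * a) :: smul c p

/-- `eval` commutes with scalars. -/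
@[simp] theorem eval_smul (c : ℚ) (p : Poly) (x : ℝ) : eval (smul c p) x = (c : ℝ) * eval p x := by
  induction p with
  | nil => simp [smul]
  | cons a p ih => simp only [smul, eval_cons, ih]; push_cast; ring

/-- Negation. -/
def neg (p : Poly) : Poly := smul (-1) p

/-- `eval` of the negation. -/
@[simp] theorem eval_neg (p : Poly) (x : ℝ) : eval (neg p) x = -eval p x := by
  simp [neg]

/-- Multiplication by the variable. -/
def mulX (p : Poly) : Poly := 0 :: p

/-- `eval (X·p) = x · eval p`. -/
@[simp] theorem eval_mulX (p : Poly) (x : ℝ) : eval (mulX p) x = x * eval p x := by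
  simp [mulX]

/-- Product. -/
def mul : Poly → Poly → Poly
  | [], _ => []
  | a :: p, q => add (smul a q) (mulX (mul p q))

/-- `eval` is multiplicative. -/
@[simp] theorem eval_mul (p q : Poly) (x : ℝ) : eval (mul p q) x = eval p x * eval q x := by
  induction p with
  | nil => simp [mul]
  | cons a p ih => simp only [mul, eval_add, eval_smul, eval_mulX, ih, eval_cons]; ring

/-- Power. -/
def pow (p : Poly) : ℕ → Poly
  | 0 => [1]
  | n + 1 => mul p (pow p n)

/-- `eval` of a power. -/
@[simp] theorem eval_pow (p : Poly) (n : ℕ) (x : ℝ) : eval (pow p n) x = eval p x ^ n := by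
  induction n with
  | zero => simp [pow]
  | succ n ih => simp only [pow, eval_mul, ih]; ring

/-- Constant polynomial. -/
def const (c : ℚ) : Poly := [c]

/-- `eval` of a constant. -/
@[simp] theorem eval_const (c : ℚ) (x : ℝ) : eval (const c) x = c := by simp [const]

/-- Substitution `x ↦ x²`: `eval (compSq p) x = eval p (x²)`. -/
def compSq : Poly → Poly
  | [] => []
  | c :: p => c :: 0 :: compSq p

/-- `eval (compSq p) x = eval p (x²)`. -/
@[simp] theorem eval_compSq (p : Poly) (x : ℝ) : eval (compSq p) x = eval p (x ^ 2) := by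
  induction p with
  | nil => simp [compSq]
  | cons c p ih => simp only [compSq, eval_cons, ih]; push_cast; ring

/-- Taylor shift: `eval (shift p l) x = eval p (x + l)`. -/
def shift : Poly → ℚ → Poly
  | [], _ => []
  | c :: p, l => add [c] (mul [l, 1] (shift p l))

/-- `eval (shift p l) x = eval p (x + l)`. -/
@[simp] theorem eval_shift (p : Poly) (l : ℚ) (x : ℝ) : eval (shift p l) x = eval p (x + l) := by
  induction p with
  | nil => simp [shift]
  | cons c p ih => simp only [shift, eval_add, eval_mul, eval_cons, eval_nil, ih]; push_cast; ring

/-! ## Calculus -/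

/-- Derivative (product-rule recursion on the Horner form). -/
def deriv : Poly → Poly
  | [] => []
  | _ :: p => add p (mulX (deriv p))

/-- `eval (deriv p)` is the derivative of `eval p`. -/
theorem hasDerivAt_eval (p : Poly) (x : ℝ) : HasDerivAt (eval p) (eval (deriv p) x) x := by
  induction p with
  | nil =>
    simp only [deriv, eval_nil]
    exact hasDerivAt_const x (0 : ℝ)
  | cons c p ih =>
    have h := ((hasDerivAt_id x).mul ih).const_add (c : ℝ)
    simp only [deriv, eval_add, eval_mulX]
    refine h.congr_deriv ?_
    simp

/-- Weighted antiderivative coefficients: `primAux k [c₀, c₁, …] = [c₀/k, c₁/(k+1), …]`. -/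
def primAux : ℕ → Poly → Poly
  | _, [] => []
  | k, c :: p => (c / k) :: primAux (k + 1) p

/-- Antiderivative vanishing at `0`. -/
def prim (p : Poly) : Poly := 0 :: primAux 1 p

/-- `d/dy (yᵏ · eval (primAux k p) y) = y^{k-1} · eval p y` (`k ≥ 1`). -/
theorem hasDerivAt_pow_mul_primAux (p : Poly) {k : ℕ} (hk : 1 ≤ k) (x : ℝ) :
    HasDerivAt (fun y ↦ y ^ k * eval (primAux k p) y) (x ^ (k - 1) * eval p x) x := by
  induction p generalizing k with
  | nil =>
    simp only [primAux, eval_nil, mul_zero]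
    exact hasDerivAt_const x (0 : ℝ)
  | cons c p ih =>
    have hk0 : (k : ℝ) ≠ 0 := by exact_mod_cast (by omega : k ≠ 0)
    have e : (fun y : ℝ ↦ y ^ k * eval (primAux k (c :: p)) y) =
        fun y ↦ (c / k : ℝ) * y ^ k + y ^ (k + 1) * eval (primAux (k + 1) p) y := by
      funext y
      simp only [primAux, eval_cons]
      push_cast
      ring
    rw [e]
    have h1 : HasDerivAt (fun y : ℝ ↦ (c / k : ℝ) * y ^ k) ((c / k : ℝ) * (k * x ^ (k - 1))) x :=
      (hasDerivAt_pow k x).const_mul _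
    have h2 := ih (k := k + 1) (by omega)
    simp only [Nat.add_sub_cancel] at h2
    refine (h1.add h2).congr_deriv ?_
    rw [show (c / k : ℝ) * (k * x ^ (k - 1)) = c * x ^ (k - 1) by field_simp]
    obtain ⟨j, rfl⟩ : ∃ j, k = j + 1 := ⟨k - 1, by omega⟩
    simp only [Nat.add_sub_cancel, eval_cons, pow_succ]
    ring

/-- `eval (prim p)` is an antiderivative of `eval p`. -/
theorem hasDerivAt_prim (p : Poly) (x : ℝ) : HasDerivAt (eval (prim p)) (eval p x) x := by
  have h := hasDerivAt_pow_mul_primAux p (k := 1) le_rfl x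
  simp only [pow_one, Nat.sub_self, pow_zero, one_mul] at h
  refine HasDerivAt.congr_of_eventuallyEq h (Filter.Eventually.of_forall fun y ↦ ?_)
  simp [prim]

/-- Definite integral of a polynomial via its antiderivative. -/
theorem integral_eval (p : Poly) (a b : ℝ) :
    ∫ x in a..b, eval p x = eval (prim p) b - eval (prim p) a :=
  integral_eq_sub_of_hasDerivAt (fun x _ ↦ hasDerivAt_prim p x)
    ((continuous_eval p).intervalIntegrable _ _)

/-- Definite integral over a rational interval as a rational number. -/
def intQ (p : Poly) (a b : ℚ) : ℚ := evalQ (prim p) b - evalQ (prim p) a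

/-- Definite integral over a rational interval, as a cast rational. -/
theorem integral_eval_rat (p : Poly) (a b : ℚ) :
    ∫ x in (a : ℝ)..b, eval p x = (intQ p a b : ℝ) := by
  rw [integral_eval, eval_ratCast, eval_ratCast, intQ]; push_cast; ring

/-! ## Interval autocorrelation `∫_{α−a}^{a} P(t) q(α − t) dt` as a polynomial in `α` -/

/-- Bivariate polynomials: lists of `Poly`-coefficients, `beval [P₀, P₁, …] α t = Σ Pₖ(α) tᵏ`. -/
def beval : List Poly → ℝ → ℝ → ℝ
  | [], _, _ => 0
  | P :: Ps, α, t => eval P α + t * beval Ps α t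

/-- Multiplication of a bivariate polynomial by `(α − t)`. -/
def bmulSub : List Poly → List Poly
  | [] => []
  | P :: Ps => mulX P :: bsubAux P Ps
where
  /-- helper: `bsubAux P Ps` represents `(α − t)·beval Ps − P`. -/
  bsubAux : Poly → List Poly → List Poly
  | P, [] => [neg P]
  | P, Q :: Qs => add (mulX Q) (neg P) :: bsubAux Q Qs

/-- Semantics of the helper `bsubAux`. -/
theorem beval_bsubAux (P : Poly) (Ps : List Poly) (α t : ℝ) :
    beval (bmulSub.bsubAux P Ps) α t = (α - t) * beval Ps α t - eval P α := by
  induction Ps generalizing P with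
  | nil => simp [bmulSub.bsubAux, beval]
  | cons Q Qs ih => simp only [bmulSub.bsubAux, beval, ih, eval_add, eval_mulX, eval_neg]; ring

/-- `beval (bmulSub P) = (α − t)·beval P`. -/
@[simp] theorem beval_bmulSub (Ps : List Poly) (α t : ℝ) :
    beval (bmulSub Ps) α t = (α - t) * beval Ps α t := by
  cases Ps with
  | nil => simp [bmulSub, beval]
  | cons P Ps => simp only [bmulSub, beval, beval_bsubAux, eval_mulX]; ring

/-- `basePow k a` is the polynomial `α ↦ (a^{k+1} − (α − a)^{k+1})/(k+1) = ∫_{α−a}^{a} tᵏ dt`. -/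
def basePow (k : ℕ) (a : ℚ) : Poly :=
  smul (1 / (k + 1)) (add (const (a ^ (k + 1))) (neg (pow [-a, 1] (k + 1))))

/-- Closed form of `basePow`. -/
theorem eval_basePow (k : ℕ) (a : ℚ) (α : ℝ) :
    eval (basePow k a) α = ((a : ℝ) ^ (k + 1) - (α - a) ^ (k + 1)) / (k + 1) := by
  simp only [basePow, eval_smul, eval_add, eval_const, eval_neg, eval_pow, eval_cons, eval_nil]
  push_cast
  ring

/-- `∫_{α−a}^{a} tᵏ dt = eval (basePow k a) α`. -/
theorem integral_pow_eq_basePow (k : ℕ) (a : ℚ) (α : ℝ) :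
    ∫ t in (α - a)..a, t ^ k = eval (basePow k a) α := by
  rw [integral_pow, eval_basePow]

/-- `bint k Ps a` is the polynomial `α ↦ ∫_{α−a}^{a} tᵏ · beval Ps α t dt`. -/
def bint : ℕ → List Poly → ℚ → Poly
  | _, [], _ => []
  | k, P :: Ps, a => add (mul P (basePow k a)) (bint (k + 1) Ps a)

/-- `beval P α ·` is continuous. -/
theorem continuous_beval (Ps : List Poly) (α : ℝ) : Continuous (fun t ↦ beval Ps α t) := by
  induction Ps with
  | nil => simp only [beval]; exact continuous_const
  | cons P Ps ih => simp only [beval]; exact continuous_const.add (continuous_id.mul ih)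

/-- `∫_{α−a}^{a} tᵏ·beval P α t dt = eval (bint k P a) α`. -/
theorem integral_bint (Ps : List Poly) (k : ℕ) (a : ℚ) (α : ℝ) :
    ∫ t in (α - a)..a, t ^ k * beval Ps α t = eval (bint k Ps a) α := by
  induction Ps generalizing k with
  | nil => simp [beval, bint]
  | cons P Ps ih =>
    have e : (fun t : ℝ ↦ t ^ k * beval (P :: Ps) α t) =
        fun t ↦ eval P α * t ^ k + t ^ (k + 1) * beval Ps α t := by
      funext t; simp only [beval, pow_succ]; ring
    rw [e, intervalIntegral.integral_add, intervalIntegral.integral_const_mul, integral_pow_eq_basePow, ih]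
    · simp [bint]
    · exact ((continuous_const.mul (continuous_pow k))).intervalIntegrable _ _
    · exact ((continuous_pow (k + 1)).mul (continuous_beval Ps α)).intervalIntegrable _ _

/-- `convAux Ps q a` is the polynomial `α ↦ ∫_{α−a}^{a} beval Ps α t · q(α − t) dt`. -/
def convAux : List Poly → Poly → ℚ → Poly
  | _, [], _ => []
  | Ps, d :: q, a => add (smul d (bint 0 Ps a)) (convAux (bmulSub Ps) q a)

/-- `∫_{α−a}^{a} beval P α t · q(α−t) dt = eval (convAux P q a) α`. -/
theorem integral_convAux (q : Poly) (Ps : List Poly) (a : ℚ) (α : ℝ) :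
    ∫ t in (α - a)..a, beval Ps α t * eval q (α - t) = eval (convAux Ps q a) α := by
  induction q generalizing Ps with
  | nil => simp [convAux]
  | cons d q ih =>
    have e : (fun t : ℝ ↦ beval Ps α t * eval (d :: q) (α - t)) =
        fun t ↦ (d : ℝ) * (t ^ 0 * beval Ps α t) + beval (bmulSub Ps) α t * eval q (α - t) := by
      funext t; simp only [eval_cons, beval_bmulSub, pow_zero, one_mul]; ring
    rw [e, intervalIntegral.integral_add, intervalIntegral.integral_const_mul, integral_bint, ih]
    · simp [convAux]
    · exact (continuous_const.mul ((continuous_pow 0).mul (continuous_beval Ps α))).intervalIntegrable _ _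
    · exact ((continuous_beval _ α).mul ((continuous_eval q).comp
        (continuous_const.sub continuous_id))).intervalIntegrable _ _

/-- Embed a univariate polynomial in `t` as a bivariate one (constant coefficients). -/
def ofUni (p : Poly) : List Poly := p.map const

/-- `beval (ofUni p) α t = eval p t`. -/
@[simp] theorem beval_ofUni (p : Poly) (α t : ℝ) : beval (ofUni p) α t = eval p t := by
  induction p with
  | nil => simp [ofUni, beval]
  | cons c p ih => simp only [ofUni, List.map_cons, beval, eval_const, eval_cons] at ih ⊢; rw [ih]

/-- **Interval autocorrelation**: `conv p q a` is the polynomial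
`α ↦ ∫_{α−a}^{a} p(t) q(α − t) dt`. -/
def conv (p q : Poly) (a : ℚ) : Poly := convAux (ofUni p) q a

/-- **The autocorrelation formula**: `∫_{α−a}^{a} p(t) q(α − t) dt = eval (conv p q a) α`. -/
theorem integral_conv (p q : Poly) (a : ℚ) (α : ℝ) :
    ∫ t in (α - a)..a, eval p t * eval q (α - t) = eval (conv p q a) α := by
  have h := integral_convAux q (ofUni p) a α
  simp only [beval_ofUni] at h
  exact h

/-! ## A lower-bound certificate for `eval p` on `[0, w]` -/

/-- `lb p w`: a rational lower bound for `eval p` on `[0, w]` (`w ≥ 0`):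
`c + x·(rest) ≥ c + min 0 (w · lb rest)`. -/
def lb : Poly → ℚ → ℚ
  | [], _ => 0
  | c :: p, w => c + min 0 (w * lb p w)

/-- `lb p w ≤ eval p x` for `x ∈ [0, w]`. -/
theorem lb_le_eval (p : Poly) {w : ℚ} {x : ℝ} (h0 : 0 ≤ x) (h1 : x ≤ w) :
    (lb p w : ℝ) ≤ eval p x := by
  induction p with
  | nil => simp [lb]
  | cons c p ih =>
    simp only [lb, eval_cons]
    push_cast
    have key : min (0 : ℝ) ((w : ℝ) * (lb p w : ℝ)) ≤ x * eval p x := by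
      rcases le_or_gt 0 (lb p w : ℝ) with hl | hl
      · exact (min_le_left _ _).trans (mul_nonneg h0 (hl.trans ih))
      · refine (min_le_right _ _).trans ?_
        calc (w : ℝ) * lb p w ≤ x * lb p w := mul_le_mul_of_nonpos_right h1 hl.le
          _ ≤ x * eval p x := mul_le_mul_of_nonneg_left ih h0
    linarith

/-- Chain certificate starting at `b` through breakpoints `bs = [b₁, …, bₘ]` (`b ≤ b₁ ≤ …`): on each
piece the lower bound `lb` of the shifted polynomial is `≥ 0` (and at the final point); pieces of
negative width certify nothing and are harmless. -/
def chainFrom (p : Poly) : ℚ → List ℚ → Bool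
  | b, [] => decide (0 ≤ lb (shift p b) 0)
  | b, b' :: bs => decide (0 ≤ lb (shift p b) (b' - b)) && chainFrom p b' bs

/-- One certified piece. -/
theorem nonneg_of_piece (p : Poly) {b b' : ℚ} (hlb : 0 ≤ lb (shift p b) (b' - b))
    {x : ℝ} (hx : (b : ℝ) ≤ x) (hx' : x ≤ b') : 0 ≤ eval p x := by
  have h := lb_le_eval (shift p b) (w := b' - b) (x := x - b) (by linarith) (by push_cast; linarith)
  simp only [eval_shift, sub_add_cancel] at h
  exact le_trans (by exact_mod_cast hlb) h

/-- A certified chain gives nonnegativity on `[b, bₘ]`. -/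
theorem nonneg_of_chainFrom (p : Poly) :
    ∀ (bs : List ℚ) (b : ℚ), chainFrom p b bs = true →
      ∀ x : ℝ, (b : ℝ) ≤ x → x ≤ ((b :: bs).getLast (List.cons_ne_nil _ _) : ℚ) → 0 ≤ eval p x
  | [], b, h, x, hx, hx' => by
    simp only [chainFrom, decide_eq_true_eq] at h
    simp only [List.getLast_singleton] at hx'
    exact nonneg_of_piece p (b' := b) (by rwa [sub_self]) hx hx'
  | b' :: bs, b, h, x, hx, hx' => by
    simp only [chainFrom, Bool.and_eq_true, decide_eq_true_eq] at h
    obtain ⟨hlb, hrest⟩ := h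
    rcases le_or_gt x (b' : ℝ) with hx1 | hx1
    · exact nonneg_of_piece p hlb hx hx1
    · rw [List.getLast_cons (List.cons_ne_nil _ _)] at hx'
      exact nonneg_of_chainFrom p bs b' hrest x hx1.le hx'

end Poly

end Summit.RiemannHypothesis.RiemannHypothesis.Theorems.GapsEvoDoorsPW
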